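import Literature.NumberTheory.Rogawski1990.TwistedComparisonSpectralSide   -- ★ the §13.5–13.10 dictionary: `TwistedComparisonData`, `Laws`, `aPacketMult_of_laws` (Thm 13.3.7 for `Π(ξ)` in the germ)
import HarnessLib

/-!
# R90-TF · S5 «Ch. 13.3 multiplicity ∕ rigidity» — §13.10 ¶3 at dictionary level: in the germ of `t(I_{ξ̃′})`, a discrete `π` with `m(π) ≠ 0` IS A MEMBER of the A-packet `Π(ξ)`
# (the 3-line corollary of ★ `TwistedComparisonData.aPacketMult_of_laws`, Thm 13.3.7 for `Π(ξ)`: «`2m(π) = α(ξ)⟨1,π⟩ + 1` on `Π(ξ)`, `0` off it»)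

Cell `hodgecm-mathlib`, crux H413 (`stmt-HodgeConjecture-24833`), route of record `HCCMUnconditional`; programme R90-TF (brief `director/R90-BRIEF.v2.md`
1f40d54518340a35), section S5 = Ch. 13.3 (base `R90-C133`), seat R90-C133-p01 (g0), socket S5#4 `R90.S5.stub_R90_1335_qsXiRigidity` ROAD α «§13.10 GLOBAL SIGN ARGUMENT»,
R90-C133-plan (g0) DEAL #3 (2026-09-04T15:39:27Z) «land FIRST the tiny corollary `mem_aPacket_of_m_ne_zero_of_laws` over the dictionary alone».  Lane
`--supports stmt-HodgeConjecture-24833 --as helper`; ONE theorem, no definition, no instance, no notation, no `sorry`; dictionary level ONLY (no pin to record objects —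
the pins are S10's zero-slice `TwistedComparisonData` datum socket + E-S4∕E-S5, see CENSUS `R90/S5/R90-C133-p01/CENSUS-SocketQsXiRigidity.md` §3).
HONEST LABEL: HC_CM is proved only modulo the 7 printed citations (2 remaining named inputs: hLiu418 = stmt-HodgeConjecture-24832, h413 = stmt-HodgeConjecture-24833)
until rung 0 closes; this file proves nothing about them — it is a class-K deduction inside the ★ dictionary (hypotheses = the printed relations `Laws` on a posited datum `𝔨`).

THE PRINT [Rogawski1990 §13.10 p. 230 ¶3 + p. 231]: separating 13.7 (3) at the e.v.p. `t(I_{ξ̃′})` of a one-dimensional `ξ ≠ ρ(θ)` and comparing with the local lifts by linear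
independence of characters (Prop. 13.8.1) gives Thm 13.3.7 for `Π(ξ)`: `m(π) = ½(α(ξ)⟨1,π⟩ + 1)` for `π ∈ Π(ξ)` and `m(π) = 0` for every other discrete `π` with `ψ_G(t(π)) = t(I_{ξ̃′})`
(★ `aPacketMult_of_laws`).  Contrapositive of the second clause: **a discrete `π` in that germ with `m(π) ≠ 0` lies in `Π(ξ)`** — the membership half of «`m(π) = ⟨1, π⟩` for all `π`
in the sum», which is what S5#4 consumes (every discrete `P` of `U(Φ₃)` with the `ξ`-string lies in `Π(ξ)`, hence `P_v ∈ Π(ξ_v) = {πⁿ, πˢ}(ξ_v)`).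

[cite: Rogawski1990, §13.10 pp. 230–231; Thm 13.3.7 p. 203; §13.8 Prop. 13.8.1 p. 213, (13.8.8) p. 227] [cite: Marshall2014, §3.4]
-/

set_option autoImplicit false
-- the mandated namespace repeats the single-problem summit's segment (`HodgeConjecture.HodgeConjecture`)
set_option linter.dupNamespace false

noncomputable section

open Literature.NumberTheory.Rogawski1990

namespace Summit.HodgeConjecture.HodgeConjecture.R90.S5

/-- **§13.10 ¶3, membership half, at dictionary level**: for a lawful twisted-comparison datum `𝔨` and a ONE-DIMENSIONAL `ξ ∈ Π(H)` not of the form `ρ(θ)`, there is an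
A-packet `P = Π(ξ)` of the datum with `ξ ↦ P` such that every discrete `π` of `G` in the germ of `t(I_{ξ̃′})` (`ψ_G(t(π)) = t(I_{ξ̃′})`) with `m(π) ≠ 0` is a MEMBER of `P`
(★ `aPacketMult_of_laws`: off `P` the identity reads `2 m(π) = 0`).  «Then `π ∈ Π` for all `π` in the sum … In particular, `m(π) = ⟨1, π⟩`.»
[cite: Rogawski1990, §13.10 pp. 230–231; Thm 13.3.7 p. 203] -/
theorem mem_aPacket_of_m_ne_zero_of_laws {TGt TG TH : Type} (𝔨 : TwistedComparisonData TGt TG TH) (h : 𝔨.Laws)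
    (ξ : 𝔨.𝔊.PacketH) (h1 : 𝔨.IsOneDimH ξ) (hnt : ¬ 𝔨.𝔊.IsTheta ξ) :
    ∃ P : 𝔨.𝔊.Packet, 𝔨.𝔊.IsAPacket P ∧ 𝔨.𝔊.liftsTo ξ P ∧
      ∀ π : 𝔨.𝔊.Rep, 𝔨.germRep π = 𝔨.germI ξ → 𝔨.𝔊.m π ≠ 0 → 𝔨.𝔊.mem π P := by
  obtain ⟨P, hA, hL, -, hm⟩ := 𝔨.aPacketMult_of_laws h ξ h1 hnt
  refine ⟨P, hA, hL, fun π hg hπ => ?_⟩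
  by_contra hmem
  have h2 := hm ⟨π, hg⟩
  rw [if_neg hmem] at h2
  have h0 : (𝔨.𝔊.m π : ℂ) = 0 := by
    have : (2 : ℂ) * (𝔨.𝔊.m π : ℂ) = 0 := h2
    exact (mul_eq_zero.mp this).resolve_left two_ne_zero
  exact hπ (by exact_mod_cast h0)

end Summit.HodgeConjecture.HodgeConjecture.R90.S5

end
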